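import Literature.AnabelianGeometry.EtaleTheta.Discharge.Sec3CuspidallyPureOfDiagonalBase
import Literature.AnabelianGeometry.EtaleTheta.Discharge.Sec3Example39ivCuspidallyPureAtGenuineBase
import Literature.AnabelianGeometry.EtaleTheta.Discharge.Sec4CoprimePullZTower
import Literature.AnabelianGeometry.EtaleTheta.BiKummerThm44HypOfGaloisCoveringZTowerAll
import Literature.AnabelianGeometry.EtaleTheta.Discharge.Sec3CuspidallyPureThetaTower
import Literature.AnabelianGeometry.EtaleTheta.Discharge.Sec3NonDilatingOfPfImage

/-!
# [EtTh] Def. 3.6 (v) «cuspidally pure» HOLDS for the tempered Frobenioid of the ℤ-TOWER over `B^temp(Π^tp_X)⁰` (rank `[ℤ : φ(H)] > 1`, PROPER `Φ^{bs-fld}`), and Example 3.9 (iv) (F-0615) at that datum (p. 304 / PDF p. 78; p. 311 / PDF p. 85)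

S. Mochizuki, *The étale theta function and its Frobenioid-theoretic manifestations*, Publ. RIMS **45** (2009)
[cite: MochizukiEtTh2009, Def 3.6 (v) p.304 (PDF p.78); Rmk 3.3.1 p.299 (PDF p.73); Ex 3.9 (iv) p.311 (PDF p.85)]:
Def. 3.6 (v) (a) «for every non-cuspidal primary element `x ∈ Φ(A)` … there exists `y ∈ Φ^{bs-fld}(A)` such that `x ≤ y`»,
(b) «`Prime(Φ(A)) = Prime(Φ(A))^ncsp ∪ Prime(Φ(A))^csp`»; Rmk. 3.3.1 «the set of primes of `Div⁺(Z^log_∞)^{Gal(Z^log_∞/Y^log)}` … is in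
natural bijective correspondence with the set of `Gal(Z^log_∞/Y^log)`-orbits of prime log-divisors».

PROOF-ONLY companion (no `def`, no instance, no new named fact).  abc-iut cell, layer L2, seat abc-iut-w6-d047 (gen 4), self-named sequel
«ZTOWER-CUSP-PURE» of the EX39-DATUM BRIDGE (p482977).  So far Def. 3.6 (v) was proved only at RANK-ONE engines (abc-iut-f-128, p480739:
`Φ^{bs-fld} = Φ`, (a) vacuous).  abc-iut-w5-d179's ℤ-tower `ZTowerTempered.temperedFrobenioid X φ R S` (p463800; `Φ₀(Π/H) ≅ ∏_{ℤ/φ(H)} ℤ_{≥0}`,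
`Φ^{bs-fld}(A) = ι(⟨diag⟩^pf)` a PROPER submonoid) is the first CONSTRUCTED tempered Frobenioid where (a) has content.  THIS FILE:
* §1 `LogDivisorModel.ZTower.dvd_diag_pow_of_isPrimary` — **every PRIMARY element `m` of `Φ₀(S) = Hom_Γ(S, Div⁺(Z_∞))` divides a power of
  the diagonal `diag = div(ϖ)`**: `χ := min(m, diag) ∈ Φ₀(S)` (abc-iut-w5-d179's `exists_coord_min`), `χ ∣ m`, `χ ≠ 1`, so by primariness
  `m ≼ χ`, i.e. `m ∣ χ^k`, whence every coordinate of `m` is `≤ k` and `m ∣ diag^k` (`dvd_iff_toAdd_coord_le`).  (Unbounded effective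
  divisors — which exist over `H ≤ ker φ` — divide no power of `diag`; they are not primary.)
* §2 `ZTowerTempered.ncsp₀_eq_top` / `csp₀_eq_bot` (the Tate tower skeleton has `nonCuspidal := ⊤`, `cuspidal := ⊥`: no cusps) and
  **`ZTowerTempered.isCuspidallyPure_temperedFrobenioid : (temperedFrobenioid X φ R S).IsCuspidallyPure`** — by this seat's reduction
  `isCuspidallyPure_ofDiagonalBase_of_primary_dvd_diag` (`Discharge/Sec3CuspidallyPureOfDiagonalBase`).
  (Stated on the defining term `ofDiagonalBase (hpf X φ) (diagonalBase X φ) …` of `temperedFrobenioid X φ R S` — definitionally the same.)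
  INDEPENDENT PARALLEL WORK: abc-iut-f-128's `Discharge/Sec3CuspidallyPureThetaTower.lean` (p-landed 02:01Z, four minutes before file 1 of this
  pair) proves Def. 3.6 (v) TWO-SIDED at abc-iut-L2-t3's `Ÿ`-skeleton WITH CUSPS by the same pointwise-minimum argument; the ℤ-tower
  (no cusps) instance here is the complementary one-sided multi-prime case, and §4 below consumes f-128's theorem BY NAME.
* §3 **`ZTowerTempered.example39_iv_cuspidallyPure_ofInducedSquare`** — Example 3.9 (iv) «`Φ_α^ell` cuspidally pure» (FACT row F-0615) at the
  Example 3.9 datum over the GENUINE base `B^temp(Π^tp_X)⁰` with (iii) := the ℤ-tower's `Φ` (perfect: `ZTowerTempered.hP`; NON-DILATING along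
  EVERY endomorphism by the primary-ray dichotomy: `ZTowerTempered.isNonDilating`, p463931), any admissible (i)-square / (ii)-package — by the
  bridge `Example39Data.example39_iv_cuspidallyPure_ofInducedSquare_ofTempered` (p482977): the first MULTI-PRIME instance of F-0615.
* §4 **`ThetaTowerTempered.example39_iv_cuspidallyPure_ofInducedSquare`** — the same at abc-iut-L2-t3's `Ÿ`-skeleton WITH CUSPS
  (`ThetaTowerTempered.temperedFrobenioid`, p-landed 01:13Z; cuspidal purity TWO-SIDED by abc-iut-f-128's
  `ThetaTowerTempered.isCuspidallyPure_temperedFrobenioid`; perfect by `ThetaTowerTempered.hP`) ⟸ ONE displayed binder `hnd` («`Φ` non-dilating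
  along every endomorphism» — the `Ÿ`-skeleton's analogue of `ZTowerTempered.isNonDilating`, not yet in the tree): the first instance of F-0615
  at a datum where Def. 3.6 (v)(b) is two-sided.
* §5 (APPENDED once abc-iut-f-128's `ThetaTowerTempered.isNonDilating_pull` landed, p486716) **`ThetaTowerTempered.example39_iv_cuspidallyPure_ofInducedSquare_closed`**
  — the binder `hnd` of §4 DISCHARGED BY NAME: F-0615 with NO binder at the `Ÿ`-skeleton WITH CUSPS, i.e. the first CLOSED instance of F-0615 at a
  datum where Def. 3.6 (v)(b) is TWO-SIDED.
HONEST LABEL: (b) is ONE-SIDED here (no cusps in the skeleton: every prime non-cuspidal); a two-sided instance needs a Def. 3.3 (iii) datum WITH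
CUSPS (abc-iut-L2-t3's Tate tower v3).  Combinatorial model over interface records; `φ` a parameter; nothing here bears on [IUTchIII] Cor. 3.12;
typed ≠ proved; no side taken. [claim: MochizukiEtTh2009, status: refereed pre-IUT]
-/

noncomputable section

namespace Literature.AnabelianGeometry.EtaleTheta

open CategoryTheory Opposite Function Literature.AlgebraicGeometry.Frobenioids Literature.AlgebraicGeometry.Frobenioids.QuasiTemperoid
  Literature.AnabelianGeometry.SemiGraphs Literature.AlgebraicGeometry.Frobenioids.QuasiTemperoid.BTempConnected

/-! ### §1. Primary log-divisors of the ℤ-tower divide a power of the diagonal -/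

namespace LogDivisorModel.ZTower

open TateTower GaloisAction

variable {Γ : Type} [Group Γ] (φ : Γ →* Multiplicative ℤ) (S : Action (Type 0) Γ)

/-- **Rmk. 3.3.1 at the ℤ-tower, in the form Def. 3.6 (v)(a) needs: a PRIMARY element of `Φ₀(S)` divides a power of `diag = div(ϖ)`**
(`min(m, diag) ∣ m` is non-trivial, so `m ≼ min(m, diag)` by primariness; hence the coordinates of `m` are bounded).
[cite: MochizukiEtTh2009, Rmk 3.3.1 p.299 (PDF p.73); Def 3.6 (v) p.304 (PDF p.78)] -/
theorem dvd_diag_pow_of_isPrimary (m : (action φ).phiZero S) (hm : IsPrimary m) : ∃ c : ℕ, m ∣ diag φ S ^ c := by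
  obtain ⟨χ, hχ⟩ := exists_coord_min φ S m (diag φ S)
  -- `χ = min(m, diag)` divides `m`
  have hχm : χ ∣ m := (dvd_iff_toAdd_coord_le φ S χ m).mpr fun s n => by
    rw [hχ s n]
    exact min_le_left _ _
  -- `χ ≠ 1`: otherwise every coordinate of `m` vanishes and `m = 1`
  have hχ1 : χ ≠ 1 := by
    intro h1
    apply hm.1
    refine coord_separating φ S fun s n => ?_
    apply Multiplicative.toAdd.injective
    have h := hχ s n
    rw [h1, map_one, toAdd_one, coord_diag, toAdd_ofAdd] at h
    rw [map_one, toAdd_one]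
    omega
  -- primariness: `m ≼ χ`, i.e. `m ∣ χ^k`
  obtain ⟨k, -, hk⟩ := hm.2 χ hχ1 (Precsim.of_dvd hχm)
  refine ⟨k, (dvd_iff_toAdd_coord_le φ S m _).mpr fun s n => ?_⟩
  have h := (dvd_iff_toAdd_coord_le φ S m _).mp hk s n
  have hle : Multiplicative.toAdd (coord φ S s n χ) ≤ 1 := by
    rw [hχ s n, coord_diag, toAdd_ofAdd]
    exact min_le_right _ _
  rw [coord_pow, toAdd_ofAdd] at h
  rw [coord_diag_pow, toAdd_ofAdd]
  calc Multiplicative.toAdd (coord φ S s n m) ≤ k * Multiplicative.toAdd (coord φ S s n χ) := h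
    _ ≤ k * 1 := Nat.mul_le_mul_left k hle
    _ = k := mul_one k

end LogDivisorModel.ZTower

/-! ### §2. Def. 3.6 (v) for the ℤ-tower's tempered Frobenioid -/

namespace ZTowerTempered

open LogDivisorModel

variable {K : Type} [Field K] (X : SemiGraphs.TemperedArithmeticGroup.{0} K) (φ : X.Pi →* Multiplicative ℤ)

/-- **Every log-divisor of the ℤ-tower is non-cuspidal** (`ncsp₀ = Φ₀`): the Tate tower skeleton has no cusps (`nonCuspidal := ⊤`).
[cite: MochizukiEtTh2009, Def 3.3 (iii) p.299 (PDF p.73)] -/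
theorem ncsp₀_eq_top (Y : (CosetCat X.Pi)ᵒᵖ) : (dm X φ).ncsp₀ Y = ⊤ :=
  eq_top_iff.mpr fun _ _ _ => Subgroup.mem_top _

/-- **No log-divisor of the ℤ-tower except `1` is cuspidal** (`csp₀ = 1`): the Tate tower skeleton has `cuspidal := ⊥`.
[cite: MochizukiEtTh2009, Def 3.3 (iii) p.299 (PDF p.73)] -/
theorem csp₀_eq_bot (Y : (CosetCat X.Pi)ᵒᵖ) : (dm X φ).csp₀ Y = ⊥ :=
  eq_bot_iff.mpr fun _ hψ => Submonoid.mem_bot.mpr (Subtype.ext (funext fun s => Subgroup.mem_bot.mp (hψ s)))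

variable (R S : ((ConnectedPart (BTemp X.Pi))ᵒᵖ ⥤ CommMonCat.{0}) → Prop)

/-- **Def. 3.6 (v) «cuspidally pure» HOLDS for the tempered Frobenioid of the ℤ-tower over `B^temp(Π^tp_X)⁰`** — rank `[ℤ : φ(H)] > 1`,
`Φ^{bs-fld}(A) = ι(⟨diag⟩^pf)` PROPER, so (a) has content: a primary `x = ι(m^{1/n})` divides `ι(diag^c) ∈ Φ^{bs-fld}(A)` (§1 + this seat's
reduction for the diagonal-base engine); (b) one-sided (no cusps). [cite: MochizukiEtTh2009, Def 3.6 (v) p.304 (PDF p.78)] -/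
theorem isCuspidallyPure_ofDiagonalBase_zTower :
    (TemperedFrobenioid.ofDiagonalBase (hpf X φ) (diagonalBase X φ) QuasiTemperoid.BTempConnected.connectedPart_isConnected
      QuasiTemperoid.BTempConnected.connectedPart_isTotallyEpimorphic QuasiTemperoid.BTempConnected.connectedPart_isOfFSMType
      R S).IsCuspidallyPure :=
  TemperedFrobenioid.isCuspidallyPure_ofDiagonalBase_of_primary_dvd_diag (hpf X φ) (diagonalBase X φ) _ _ _ R S
    (fun _ => ncsp₀_eq_top X φ _) (fun _ => csp₀_eq_bot X φ _)
    (fun A m hm => ZTower.dvd_diag_pow_of_isPrimary φ (gset X A) m hm)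

/-! ### §3. Example 3.9 (iv) (F-0615) at the Example 3.9 datum with (iii) := the ℤ-tower's `Φ` — the first multi-prime instance -/

variable {GU GX GY : Type} [Group GU] [TopologicalSpace GU]
  [Group GX] [TopologicalSpace GX] [IsTopologicalGroup GX] [Group GY] [TopologicalSpace GY] [IsTopologicalGroup GY]
  (iUX : GU →* GX) (iUY : GU →* GY) (iXW : GX →* X.Pi) (iYW : GY →* X.Pi)
  (hUX : IsOpenMap iUX) (hUY : IsOpenMap iUY) (hXW : IsOpenMap iXW) (hYW : IsOpenMap iYW)
  (cUX : Continuous iUX) (cUY : Continuous iUY) (cXW : Continuous iXW) (cYW : Continuous iYW)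
  (hQX : ∀ V : Subgroup GX, IsOpen (V : Set GX) → Countable (GX ⧸ V))
  (hQY : ∀ V : Subgroup GY, IsOpen (V : Set GY) → Countable (GY ⧸ V))
  (hQW : ∀ V : Subgroup X.Pi, IsOpen (V : Set X.Pi) → Countable (X.Pi ⧸ V))
  (hsq : iXW.comp iUX = iYW.comp iUY)
  (ellY : ObjectProperty (ConnectedPart (BTemp GY)))
  (toEllY : ConnectedPart (BTemp GY) ⥤ ellY.FullSubcategory) (adjY : toEllY ⊣ ellY.ι)
  (ellW : ObjectProperty (ConnectedPart (BTemp X.Pi)))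
  (toEllW : ConnectedPart (BTemp X.Pi) ⥤ ellW.FullSubcategory) (adjW : toEllW ⊣ ellW.ι)
  {A B : ConnectedPart (BTemp X.Pi)} (α : A ⟶ B)
  (IsRationalα IsStrictlyRationalα : ((Example39Data.Dα α)ᵒᵖ ⥤ CommMonCat.{0}) → Prop)

/-- **Example 3.9 (iv) «`Φ_α^ell` is cuspidally pure» (F-0615) at the Example 3.9 datum over the genuine base `B^temp(Π^tp_X)⁰` with
(iii) := the ℤ-tower's `Φ`** (perfect `hP`; non-dilating along EVERY endomorphism, abc-iut-w5-d179's primary-ray dichotomy `isNonDilating`),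
for any admissible (i)-square of open continuous homomorphisms into `Π^tp_X` and any (ii)-package — the first MULTI-PRIME instance of the
refuted-closure row F-0615, by the bridge `example39_iv_cuspidallyPure_ofInducedSquare_ofTempered` and §2.
[cite: MochizukiEtTh2009, Ex 3.9 (iv) p.311 (PDF p.85); Def 3.6 (v) p.304 (PDF p.78)] -/
theorem example39_iv_cuspidallyPure_ofInducedSquare :
    (Example39Data.ofInducedSquare iUX iUY iXW iYW hUX hUY hXW hYW cUX cUY cXW cYW hQX hQY hQW hsq treeMonoidVocabWeak.{0}
      ((RealifiedDivisorMonoids.ofRlfZWeak (dm X φ) (hpf X φ)).precomp (temperedFrobenioid X φ R S).base) ellY toEllY adjY ellW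
      toEllW adjW (temperedFrobenioid X φ R S).Φ (hP X φ R S) (temperedFrobenioid X φ R S).isGroupSaturated
      (temperedFrobenioid X φ R S).isPerfFactorial (isNonDilating X φ R S)).Example39_iv_cuspidallyPure α
      (Example39Data.frobenioidHyp_ofInducedSquare_ofTempered iUX iUY iXW iYW hUX hUY hXW hYW cUX cUY cXW cYW hQX hQY hQW hsq ellY
        toEllY adjY ellW toEllW adjW (temperedFrobenioid X φ R S) (hP X φ R S) (isNonDilating X φ R S) α IsRationalα IsStrictlyRationalα) :=
  Example39Data.example39_iv_cuspidallyPure_ofInducedSquare_ofTempered iUX iUY iXW iYW hUX hUY hXW hYW cUX cUY cXW cYW hQX hQY hQW hsq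
    ellY toEllY adjY ellW toEllW adjW _ _ _ α IsRationalα IsStrictlyRationalα (isCuspidallyPure_ofDiagonalBase_zTower X φ R S)

end ZTowerTempered

/-! ### §4. F-0615 at the `Ÿ`-skeleton WITH CUSPS (two-sided Def. 3.6 (v), abc-iut-f-128) ⟸ the non-dilating binder -/

namespace ThetaTowerTempered

variable {K : Type} [Field K] (X : SemiGraphs.TemperedArithmeticGroup.{0} K) (φ : X.Pi →* Multiplicative ℤ)
  (R S : ((ConnectedPart (BTemp X.Pi))ᵒᵖ ⥤ CommMonCat.{0}) → Prop)
  (hnd : ∀ (A : (ConnectedPart (BTemp X.Pi))ᵒᵖ) (f : A ⟶ A),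
    treeMonoidVocabWeak.{0}.IsNonDilating ((temperedFrobenioid X φ R S).Φ.carrier A) ((temperedFrobenioid X φ R S).Φ.pull f))
  {GU GX GY : Type} [Group GU] [TopologicalSpace GU]
  [Group GX] [TopologicalSpace GX] [IsTopologicalGroup GX] [Group GY] [TopologicalSpace GY] [IsTopologicalGroup GY]
  (iUX : GU →* GX) (iUY : GU →* GY) (iXW : GX →* X.Pi) (iYW : GY →* X.Pi)
  (hUX : IsOpenMap iUX) (hUY : IsOpenMap iUY) (hXW : IsOpenMap iXW) (hYW : IsOpenMap iYW)
  (cUX : Continuous iUX) (cUY : Continuous iUY) (cXW : Continuous iXW) (cYW : Continuous iYW)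
  (hQX : ∀ V : Subgroup GX, IsOpen (V : Set GX) → Countable (GX ⧸ V))
  (hQY : ∀ V : Subgroup GY, IsOpen (V : Set GY) → Countable (GY ⧸ V))
  (hQW : ∀ V : Subgroup X.Pi, IsOpen (V : Set X.Pi) → Countable (X.Pi ⧸ V))
  (hsq : iXW.comp iUX = iYW.comp iUY)
  (ellY : ObjectProperty (ConnectedPart (BTemp GY)))
  (toEllY : ConnectedPart (BTemp GY) ⥤ ellY.FullSubcategory) (adjY : toEllY ⊣ ellY.ι)
  (ellW : ObjectProperty (ConnectedPart (BTemp X.Pi)))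
  (toEllW : ConnectedPart (BTemp X.Pi) ⥤ ellW.FullSubcategory) (adjW : toEllW ⊣ ellW.ι)
  {A B : ConnectedPart (BTemp X.Pi)} (α : A ⟶ B)
  (IsRationalα IsStrictlyRationalα : ((Example39Data.Dα α)ᵒᵖ ⥤ CommMonCat.{0}) → Prop)

/-- **Example 3.9 (iv) «`Φ_α^ell` is cuspidally pure» (F-0615) at the Example 3.9 datum over `B^temp(Π^tp_X)⁰` with (iii) := the `Φ` of the
`Ÿ`-skeleton WITH CUSPS** (abc-iut-L2-t3's `ThetaTowerTempered.temperedFrobenioid`; Def. 3.6 (v) TWO-SIDED there by abc-iut-f-128's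
`isCuspidallyPure_temperedFrobenioid`, perfect by `hP`) ⟸ the displayed binder `hnd` («non-dilating along every endomorphism», [FrdI] Def. 1.1 (i)).
[cite: MochizukiEtTh2009, Ex 3.9 (iv) p.311 (PDF p.85); Def 3.6 (v) p.304 (PDF p.78)] -/
theorem example39_iv_cuspidallyPure_ofInducedSquare :
    (Example39Data.ofInducedSquare iUX iUY iXW iYW hUX hUY hXW hYW cUX cUY cXW cYW hQX hQY hQW hsq treeMonoidVocabWeak.{0}
      ((RealifiedDivisorMonoids.ofRlfZWeak (dm X φ) (hpf X φ)).precomp (temperedFrobenioid X φ R S).base) ellY toEllY adjY ellW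
      toEllW adjW (temperedFrobenioid X φ R S).Φ (hP X φ R S) (temperedFrobenioid X φ R S).isGroupSaturated
      (temperedFrobenioid X φ R S).isPerfFactorial hnd).Example39_iv_cuspidallyPure α
      (Example39Data.frobenioidHyp_ofInducedSquare_ofTempered iUX iUY iXW iYW hUX hUY hXW hYW cUX cUY cXW cYW hQX hQY hQW hsq ellY
        toEllY adjY ellW toEllW adjW (temperedFrobenioid X φ R S) (hP X φ R S) hnd α IsRationalα IsStrictlyRationalα) :=
  Example39Data.example39_iv_cuspidallyPure_ofInducedSquare_ofTempered iUX iUY iXW iYW hUX hUY hXW hYW cUX cUY cXW cYW hQX hQY hQW hsq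
    ellY toEllY adjY ellW toEllW adjW _ _ _ α IsRationalα IsStrictlyRationalα (isCuspidallyPure_temperedFrobenioid X φ R S)

end ThetaTowerTempered

/-! ### §5. The binder of §4 discharged: F-0615 CLOSED at the `Ÿ`-skeleton with cusps (two-sided Def. 3.6 (v)) -/

namespace ThetaTowerTempered

variable {K : Type} [Field K] (X : SemiGraphs.TemperedArithmeticGroup.{0} K) (φ : X.Pi →* Multiplicative ℤ)
  (R S : ((ConnectedPart (BTemp X.Pi))ᵒᵖ ⥤ CommMonCat.{0}) → Prop)
  {GU GX GY : Type} [Group GU] [TopologicalSpace GU]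
  [Group GX] [TopologicalSpace GX] [IsTopologicalGroup GX] [Group GY] [TopologicalSpace GY] [IsTopologicalGroup GY]
  (iUX : GU →* GX) (iUY : GU →* GY) (iXW : GX →* X.Pi) (iYW : GY →* X.Pi)
  (hUX : IsOpenMap iUX) (hUY : IsOpenMap iUY) (hXW : IsOpenMap iXW) (hYW : IsOpenMap iYW)
  (cUX : Continuous iUX) (cUY : Continuous iUY) (cXW : Continuous iXW) (cYW : Continuous iYW)
  (hQX : ∀ V : Subgroup GX, IsOpen (V : Set GX) → Countable (GX ⧸ V))
  (hQY : ∀ V : Subgroup GY, IsOpen (V : Set GY) → Countable (GY ⧸ V))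
  (hQW : ∀ V : Subgroup X.Pi, IsOpen (V : Set X.Pi) → Countable (X.Pi ⧸ V))
  (hsq : iXW.comp iUX = iYW.comp iUY)
  (ellY : ObjectProperty (ConnectedPart (BTemp GY)))
  (toEllY : ConnectedPart (BTemp GY) ⥤ ellY.FullSubcategory) (adjY : toEllY ⊣ ellY.ι)
  (ellW : ObjectProperty (ConnectedPart (BTemp X.Pi)))
  (toEllW : ConnectedPart (BTemp X.Pi) ⥤ ellW.FullSubcategory) (adjW : toEllW ⊣ ellW.ι)
  {A B : ConnectedPart (BTemp X.Pi)} (α : A ⟶ B)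
  (IsRationalα IsStrictlyRationalα : ((Example39Data.Dα α)ᵒᵖ ⥤ CommMonCat.{0}) → Prop)

/-- **Example 3.9 (iv) «`Φ_α^ell` is cuspidally pure» (F-0615) with NO binder at the Example 3.9 datum over `B^temp(Π^tp_X)⁰` with (iii) := the
`Φ` of the `Ÿ`-skeleton WITH CUSPS** — Def. 3.6 (v) TWO-SIDED there (abc-iut-f-128's `isCuspidallyPure_temperedFrobenioid`), perfect (`hP`,
abc-iut-L2-t3), non-dilating along every endomorphism (abc-iut-f-128's `isNonDilating_pull`, Prop. 3.4 (i)); any admissible (i)-square /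
(ii)-package. [cite: MochizukiEtTh2009, Ex 3.9 (iv) p.311 (PDF p.85); Def 3.6 (v) p.304 (PDF p.78)] -/
theorem example39_iv_cuspidallyPure_ofInducedSquare_closed :
    (Example39Data.ofInducedSquare iUX iUY iXW iYW hUX hUY hXW hYW cUX cUY cXW cYW hQX hQY hQW hsq treeMonoidVocabWeak.{0}
      ((RealifiedDivisorMonoids.ofRlfZWeak (dm X φ) (hpf X φ)).precomp (temperedFrobenioid X φ R S).base) ellY toEllY adjY ellW
      toEllW adjW (temperedFrobenioid X φ R S).Φ (hP X φ R S) (temperedFrobenioid X φ R S).isGroupSaturated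
      (temperedFrobenioid X φ R S).isPerfFactorial (isNonDilating_pull X φ R S)).Example39_iv_cuspidallyPure α
      (Example39Data.frobenioidHyp_ofInducedSquare_ofTempered iUX iUY iXW iYW hUX hUY hXW hYW cUX cUY cXW cYW hQX hQY hQW hsq ellY
        toEllY adjY ellW toEllW adjW (temperedFrobenioid X φ R S) (hP X φ R S) (isNonDilating_pull X φ R S) α IsRationalα
        IsStrictlyRationalα) :=
  example39_iv_cuspidallyPure_ofInducedSquare X φ R S (isNonDilating_pull X φ R S) iUX iUY iXW iYW hUX hUY hXW hYW cUX cUY cXW cYW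
    hQX hQY hQW hsq ellY toEllY adjY ellW toEllW adjW α IsRationalα IsStrictlyRationalα

end ThetaTowerTempered

end Literature.AnabelianGeometry.EtaleTheta

end
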